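import Summits.Parity.GeneralizedHardyLittlewood.Theorems.PrimeLevelFamEdgeMomentsBeyondDiagonalDiagDecorShiftedBlock
import Summits.Parity.GeneralizedHardyLittlewood.Theorems.PrimeLevelFamEdgeMomentsBeyondDiagonalDiagDecorMasterInputsLog
import HarnessLib

/-!
# Route `PrimeLevelFamEdge`, crux K_A `MomentsBeyondDiagonal` (stmt-Parity-20007), line «petersson_layers» v4, stub `stub_diag`:
# **the DECORATED shifted block `Sel(τD(k₁)ℓ⁺(k₁)^{r₁}·τ(k₂)ℓ⁺(k₂)^{r₂}·B^p)` for an extra decoration `D` on `k₁` with a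
# master-input family `(R_r, s)` — and the instance `D = P₂` (`R_r = −2X^rP`, `s = 0`) of the order-`(1,1)` weight**

Census R3(ii), ANALYTIC HALF; continuation of `…DiagDecorShiftedCoord` / `…DiagDecorShiftedBlock` (the `β + ℓ⁺` scheme,
`B = λlog M − log g − log(M/(cg))`, `ℓ⁺(k) = log((M/(cg))/k)`). The order-`(1,1)` polynomial part (`…DiagDecorWeightOneOne`)
has, besides `Sel(ττL^m)`, the family `Sel(ττP₂(k₁)L^m)` (`P₂(k) = Σ_{p∣k}log²p`); higher orders bring further decorations
`D(k₁)` (products of `P_j`). This file treats an ABSTRACT decoration `D : ℕ → ℝ` on `k₁` whose shifted coordinates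
`T^{[r]}(M,n) = Σ_c P_c(Σ_k W[(k,n)=1]τ(k)D(k)log^{c+r}((M/n)/k))/logᶜM` satisfy, for every `r`, the two-scale master format
`|T^{[r]}/log^rM − E_nR_r(u_n)/log^sM| ≤ C_r·D(n)((1+κ)/log^{s+1}M + 1/((1+log(M/n))²log^sM))`:

* `abs_harmonicShiftedDecor_sub_le` — `Σ_n φW²(λlog M − log(M/n))^p T^{[r₁]}𝒮^{[r₂]} =
  (π²/6)²(∫₀¹(λ−u)^pR_{r₁}(u)(u^{r₂}P)″du)·log^{p+r₁+r₂}M·log M/log^{s+2}M + O(log^{p+r₁+r₂}M/log^{s+2}M)`;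
* `abs_collapseShiftedDecor_logPow_le` — the `(log g)^t` pieces (`t ≥ 1`) are `O(log^{t+q+r₁+r₂}M/log^{s+2}M)`;
* `selbergBlockDecor_expand`, `abs_selbergBlockDecor_sub_le` — exact expansion along `−log g` and **the block asymptotic
  `Sel(τDℓ⁺^{r₁}·τℓ⁺^{r₂}·B^p) = (π²/6)²(∫₀¹(λ−u)^pR_{r₁}(u^{r₂}P)″)·log^{p+r₁+r₂}M·log M/log^{s+2}M + O(log^{p+r₁+r₂}M/log^{s+2}M)`**;
* `abs_shiftedCoordPrimeSq_sub_le` — the instance `D = P₂`: `R_r = −2·X^rP`, `s = 0` (`…DiagDecorMasterInputsLog.masterInput_tau_primeSq`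
  at the shifted profile `X^rP`), so `Sel(ττP₂(k₁)ℓ⁺^{r₁}ℓ⁺^{r₂}B^p) ≈ (π²/6)²(∫(λ−u)^p(−2u^{r₁}P)(u^{r₂}P)″)·log^{p+r₁+r₂+1}M/log²M`.

Def-free; theorems only. Helper `--supports stmt-Parity-20007`; closes nothing; K_A, K_B and the Parity summit are NOT
proved; nothing about Landau–Siegel zeros.

## References
* E. Kowalski, P. Michel, J. VanderKam, J. reine angew. Math. 526 (2000), (23)–(28) pp. 13–15 and Prop. 5.1 p. 18.
  [cite: KowalskiMichelVanderKam2000, (23)–(28) — derivation (diagonal main term in real Selberg coordinates)]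
-/

noncomputable section

open scoped Real ArithmeticFunction.Moebius
open Finset ArithmeticFunction Polynomial MeasureTheory intervalIntegral

namespace Summit.Parity.GeneralizedHardyLittlewood.Theorems.MomentsBeyondDiagonal.DiagKernel

open Literature.NumberTheory.LFunctions Literature.NumberTheory.LFunctions.KMV2000
open MollifierMainTerm (W)
open SelbergCoord (kappa)
open Literature.NumberTheory.Sieve (one_le_log_of_three_le)
open Summit.Parity.GeneralizedHardyLittlewood.Theorems.BeyondDiagonalBeatsQuarter.KernelFormXSq
  (mainConst divWeight divWeight_nonneg mainConst_nonneg abs_W_le sum_kappa_divWeight_sq_div_le)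

/-- `κ(n) ≥ 0`. [folklore] -/
private theorem kappa_nonneg₃ (n : ℕ) : 0 ≤ kappa n := by
  unfold kappa
  exact Finset.sum_nonneg fun p hp ↦ by
    have hp2 : (2 : ℝ) ≤ p := by exact_mod_cast (Nat.prime_of_mem_primeFactors hp).two_le
    exact div_nonneg (Real.log_nonneg (by linarith)) (by linarith)

variable (Dk : ℕ → ℝ) (R : ℕ → ℝ[X]) (s : ℕ)

/-! ### The harmonic main term with a decorated first coordinate -/

/-- **Bilinear main term, decorated first coordinate** (see the module docstring; `0 ≤ λ ≤ 1`, `P₀ = P₁ = 0`).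
[cite: KowalskiMichelVanderKam2000, (23)–(28) and Prop. 5.1 — derivation] -/
theorem abs_harmonicShiftedDecor_sub_le (P : ℝ[X]) (hP0 : P.coeff 0 = 0) (hP1 : P.coeff 1 = 0) (p r₁ r₂ : ℕ)
    {lam : ℝ} (hlam0 : 0 ≤ lam) (hlam1 : lam ≤ 1) {C₁ : ℝ} (hC₁ : 0 ≤ C₁)
    (hT : ∀ M : ℝ, 3 ≤ M → ∀ n : ℕ, n ≠ 0 → (n : ℝ) ≤ M →
      |(∑ c ∈ Finset.range (P.natDegree + 1), P.coeff c *
          ((∑ k ∈ Icc 1 ⌊M / n⌋₊, (if k.Coprime n then W k else 0) * ((k.divisors.card : ℝ) * Dk k) *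
            Real.log (M / n / k) ^ (c + r₁)) / Real.log M ^ c)) / Real.log M ^ r₁ -
        mainConst n * (R r₁).eval (Real.log (M / n) / Real.log M) / Real.log M ^ s| ≤
        C₁ * divWeight n * ((1 + kappa n) / Real.log M ^ (s + 1) + 1 / ((1 + Real.log (M / n)) ^ 2 * Real.log M ^ s))) :
    ∃ C : ℝ, 0 < C ∧ ∀ M : ℝ, 3 ≤ M →
      |∑ n ∈ Icc 1 ⌊M⌋₊, (Nat.totient n : ℝ) * W n ^ 2 *
          ((lam * Real.log M - Real.log (M / n)) ^ p *
            (∑ c ∈ Finset.range (P.natDegree + 1), P.coeff c *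
              ((∑ k ∈ Icc 1 ⌊M / n⌋₊, (if k.Coprime n then W k else 0) * ((k.divisors.card : ℝ) * Dk k) *
                Real.log (M / n / k) ^ (c + r₁)) / Real.log M ^ c)) *
            (∑ c ∈ Finset.range (P.natDegree + 1), P.coeff c *
              ((∑ k ∈ Icc 1 ⌊M / n⌋₊, (if k.Coprime n then W k else 0) * (k.divisors.card : ℝ) *
                Real.log (M / n / k) ^ (c + r₂)) / Real.log M ^ c))) -
        (π ^ 2 / 6) ^ 2 * (∫ u in (0 : ℝ)..1,
            (((Polynomial.C lam - X) ^ p * R r₁) * derivative (derivative (X ^ r₂ * P))).eval u) *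
          Real.log M ^ (p + r₁ + r₂) * Real.log M / Real.log M ^ (s + 2)| ≤
        C * Real.log M ^ (p + r₁ + r₂) / Real.log M ^ (s + 2) := by
  obtain ⟨C₂, hC₂, h₂⟩ := abs_shiftedCoord_sub_le P hP0 hP1 r₂
  set T₁ : ℝ → ℕ → ℝ := fun M n ↦ (lam - Real.log (M / n) / Real.log M) ^ p *
    ((∑ c ∈ Finset.range (P.natDegree + 1), P.coeff c *
      ((∑ k ∈ Icc 1 ⌊M / n⌋₊, (if k.Coprime n then W k else 0) * ((k.divisors.card : ℝ) * Dk k) *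
        Real.log (M / n / k) ^ (c + r₁)) / Real.log M ^ c)) / Real.log M ^ r₁) with hT₁
  set T₂ : ℝ → ℕ → ℝ := fun M n ↦
    (∑ c ∈ Finset.range (P.natDegree + 1), P.coeff c *
      ((∑ k ∈ Icc 1 ⌊M / n⌋₊, (if k.Coprime n then W k else 0) * (k.divisors.card : ℝ) *
        Real.log (M / n / k) ^ (c + r₂)) / Real.log M ^ c)) / Real.log M ^ r₂ with hT₂
  set R₁ : ℝ[X] := (Polynomial.C lam - X) ^ p * R r₁ with hR₁
  set R₂ : ℝ[X] := derivative (derivative (X ^ r₂ * P)) with hR₂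
  have hT₁' : ∀ M : ℝ, 3 ≤ M → ∀ n : ℕ, n ≠ 0 → (n : ℝ) ≤ M →
      |T₁ M n - mainConst n * R₁.eval (Real.log (M / n) / Real.log M) / Real.log M ^ s| ≤
        C₁ * divWeight n * ((1 + kappa n) / Real.log M ^ (s + 1) +
          1 / ((1 + Real.log (M / n)) ^ 2 * Real.log M ^ s)) := by
    intro M hM n hn hnM
    have hℓ1 : 1 ≤ Real.log M := one_le_log_of_three_le hM
    have hℓpos : 0 < Real.log M := by linarith
    obtain ⟨hY0, hYℓ⟩ := log_div_nonneg_and_le hM hn hnM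
    set u := Real.log (M / n) / Real.log M with hu
    have hu0 : 0 ≤ u := div_nonneg hY0 hℓpos.le
    have hu1 : u ≤ 1 := (div_le_one hℓpos).2 hYℓ
    have hfac : |(lam - u) ^ p| ≤ 1 := by
      rw [abs_pow]
      exact pow_le_one₀ (abs_nonneg _) (abs_le.2 ⟨by linarith, by linarith⟩)
    have hR₁eval : R₁.eval u = (lam - u) ^ p * (R r₁).eval u := by
      simp only [hR₁, Polynomial.eval_mul, Polynomial.eval_pow, Polynomial.eval_sub, Polynomial.eval_C,
        Polynomial.eval_X]
    have hdiff : T₁ M n - mainConst n * R₁.eval u / Real.log M ^ s =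
        (lam - u) ^ p * ((∑ c ∈ Finset.range (P.natDegree + 1), P.coeff c *
          ((∑ k ∈ Icc 1 ⌊M / n⌋₊, (if k.Coprime n then W k else 0) * ((k.divisors.card : ℝ) * Dk k) *
            Real.log (M / n / k) ^ (c + r₁)) / Real.log M ^ c)) / Real.log M ^ r₁ -
          mainConst n * (R r₁).eval u / Real.log M ^ s) := by
      rw [hT₁, hR₁eval]; ring
    rw [hdiff, abs_mul]
    have h := hT M hM n hn hnM
    calc |(lam - u) ^ p| * _ ≤ 1 * (C₁ * divWeight n * ((1 + kappa n) / Real.log M ^ (s + 1) +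
          1 / ((1 + Real.log (M / n)) ^ 2 * Real.log M ^ s))) :=
          mul_le_mul hfac h (abs_nonneg _) zero_le_one
      _ = _ := one_mul _
  have hT₂' : ∀ M : ℝ, 3 ≤ M → ∀ n : ℕ, n ≠ 0 → (n : ℝ) ≤ M →
      |T₂ M n - mainConst n * R₂.eval (Real.log (M / n) / Real.log M) / Real.log M ^ 2| ≤
        C₂ * divWeight n * ((1 + kappa n) / Real.log M ^ (2 + 1) +
          1 / ((1 + Real.log (M / n)) ^ 2 * Real.log M ^ 2)) := by
    intro M hM n hn hnM
    simpa only [hT₂, hR₂] using h₂ M hM n hn hnM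
  obtain ⟨C, hC, h⟩ := abs_bilinearHarmonic_two_scale_sub_le R₁ R₂ s 2 T₁ T₂ hC₁ hC₂ hT₁' hT₂'
  refine ⟨C, hC, fun M hM ↦ ?_⟩
  have hℓ1 : 1 ≤ Real.log M := one_le_log_of_three_le hM
  have hℓpos : 0 < Real.log M := by linarith
  have hℓ0 : Real.log M ≠ 0 := hℓpos.ne'
  have h' := h M hM
  have hresc : ∑ n ∈ Icc 1 ⌊M⌋₊, (Nat.totient n : ℝ) * W n ^ 2 *
      ((lam * Real.log M - Real.log (M / n)) ^ p *
        (∑ c ∈ Finset.range (P.natDegree + 1), P.coeff c *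
          ((∑ k ∈ Icc 1 ⌊M / n⌋₊, (if k.Coprime n then W k else 0) * ((k.divisors.card : ℝ) * Dk k) *
            Real.log (M / n / k) ^ (c + r₁)) / Real.log M ^ c)) *
        (∑ c ∈ Finset.range (P.natDegree + 1), P.coeff c *
          ((∑ k ∈ Icc 1 ⌊M / n⌋₊, (if k.Coprime n then W k else 0) * (k.divisors.card : ℝ) *
            Real.log (M / n / k) ^ (c + r₂)) / Real.log M ^ c))) =
      Real.log M ^ (p + r₁ + r₂) * ∑ n ∈ Icc 1 ⌊M⌋₊, (Nat.totient n : ℝ) * W n ^ 2 * (T₁ M n * T₂ M n) := by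
    rw [Finset.mul_sum]
    refine Finset.sum_congr rfl fun n _ ↦ ?_
    have hfac : (lam * Real.log M - Real.log (M / n)) ^ p =
        Real.log M ^ p * (lam - Real.log (M / n) / Real.log M) ^ p := by
      rw [← mul_pow]; congr 1; field_simp
    simp only [hT₁, hT₂]
    rw [hfac, pow_add, pow_add]
    field_simp
  rw [hresc]
  have e : Real.log M ^ (p + r₁ + r₂) * ∑ n ∈ Icc 1 ⌊M⌋₊, (Nat.totient n : ℝ) * W n ^ 2 * (T₁ M n * T₂ M n) -
      (π ^ 2 / 6) ^ 2 * (∫ u in (0 : ℝ)..1, (R₁ * R₂).eval u) * Real.log M ^ (p + r₁ + r₂) * Real.log M /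
        Real.log M ^ (s + 2) =
      Real.log M ^ (p + r₁ + r₂) * (∑ n ∈ Icc 1 ⌊M⌋₊, (Nat.totient n : ℝ) * W n ^ 2 * (T₁ M n * T₂ M n) -
        (π ^ 2 / 6) ^ 2 * (∫ u in (0 : ℝ)..1, (R₁ * R₂).eval u) * Real.log M / Real.log M ^ (s + 2)) := by
    ring
  rw [e, abs_mul, abs_of_pos (pow_pos hℓpos _)]
  calc Real.log M ^ (p + r₁ + r₂) * _ ≤ Real.log M ^ (p + r₁ + r₂) * (C / Real.log M ^ (s + 2)) :=
        mul_le_mul_of_nonneg_left h' (pow_nonneg hℓpos.le _)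
    _ = C * Real.log M ^ (p + r₁ + r₂) / Real.log M ^ (s + 2) := by ring

/-! ### The `(log g)^t` pieces, decorated first coordinate -/

/-- **The `(log g)^t` pieces of a decorated shifted block are one logarithm small** (`t ≥ 1`; crude sizes
`|T^{[r₁]}| ≤ K₁D(n)log^{r₁}M/log^sM`, `|𝒮^{[r₂]}| ≤ K₂D(n)log^{r₂}M/log²M`).
[cite: KowalskiMichelVanderKam2000, (23)–(28) — derivation (log g terms of the diagonal main term)] -/
theorem abs_collapseShiftedDecor_logPow_le (P : ℝ[X]) (hP0 : P.coeff 0 = 0) (hP1 : P.coeff 1 = 0) {t : ℕ}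
    (ht : 1 ≤ t) (q r₁ r₂ : ℕ) {lam : ℝ} (hlam0 : 0 ≤ lam) (hlam1 : lam ≤ 1) {K₁ : ℝ} (hK₁ : 0 ≤ K₁)
    (hb₁ : ∀ M : ℝ, 3 ≤ M → ∀ n : ℕ, n ≠ 0 → (n : ℝ) ≤ M →
      |∑ c ∈ Finset.range (P.natDegree + 1), P.coeff c *
          ((∑ k ∈ Icc 1 ⌊M / n⌋₊, (if k.Coprime n then W k else 0) * ((k.divisors.card : ℝ) * Dk k) *
            Real.log (M / n / k) ^ (c + r₁)) / Real.log M ^ c)| ≤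
        K₁ * divWeight n * Real.log M ^ r₁ / Real.log M ^ s) :
    ∃ C : ℝ, 0 < C ∧ ∀ M : ℝ, 3 ≤ M →
      |∑ c ∈ Icc 1 ⌊M⌋₊, ∑ g ∈ Icc 1 (⌊M⌋₊ / c), (μ g : ℝ) * c * Real.log g ^ t * (W (c * g) ^ 2 *
          ((lam * Real.log M - Real.log (M / ((c * g : ℕ) : ℝ))) ^ q *
            (∑ c' ∈ Finset.range (P.natDegree + 1), P.coeff c' *
              ((∑ k ∈ Icc 1 ⌊M / ((c * g : ℕ) : ℝ)⌋₊, (if k.Coprime (c * g) then W k else 0) *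
                ((k.divisors.card : ℝ) * Dk k) * Real.log (M / ((c * g : ℕ) : ℝ) / k) ^ (c' + r₁)) / Real.log M ^ c')) *
            (∑ c' ∈ Finset.range (P.natDegree + 1), P.coeff c' *
              ((∑ k ∈ Icc 1 ⌊M / ((c * g : ℕ) : ℝ)⌋₊, (if k.Coprime (c * g) then W k else 0) * (k.divisors.card : ℝ) *
                Real.log (M / ((c * g : ℕ) : ℝ) / k) ^ (c' + r₂)) / Real.log M ^ c'))))| ≤
        C * Real.log M ^ (t + q + r₁ + r₂) / Real.log M ^ (s + 2) := by
  obtain ⟨K₂, hK₂, hb₂⟩ := abs_shiftedCoord_le P hP0 hP1 r₂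
  set S₁ : ℝ → ℕ → ℝ := fun M n ↦ ∑ c' ∈ Finset.range (P.natDegree + 1), P.coeff c' *
    ((∑ k ∈ Icc 1 ⌊M / n⌋₊, (if k.Coprime n then W k else 0) * ((k.divisors.card : ℝ) * Dk k) *
      Real.log (M / n / k) ^ (c' + r₁)) / Real.log M ^ c') with hS₁
  set S₂ : ℝ → ℕ → ℝ := fun M n ↦ ∑ c' ∈ Finset.range (P.natDegree + 1), P.coeff c' *
    ((∑ k ∈ Icc 1 ⌊M / n⌋₊, (if k.Coprime n then W k else 0) * (k.divisors.card : ℝ) *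
      Real.log (M / n / k) ^ (c' + r₂)) / Real.log M ^ c') with hS₂
  set A : ℝ := (∑' d : ℕ, (d : ℝ) ^ (-(5 / 4 : ℝ))) ^ 2 with hA
  have hA0 : 0 ≤ A := by positivity
  refine ⟨K₁ * K₂ * (48 * A * 3) + 1, by positivity, fun M hM ↦ ?_⟩
  set ℓ := Real.log M with hℓ
  have hℓ1 : 1 ≤ ℓ := one_le_log_of_three_le hM
  have hℓ0 : 0 < ℓ := by linarith
  have hM0 : 0 < M := by linarith
  set N := ⌊M⌋₊ with hN
  have hN1 : 1 ≤ N := Nat.le_floor (by norm_num; linarith)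
  have hlogN : Real.log N ≤ ℓ := Real.log_le_log (by exact_mod_cast hN1) (Nat.floor_le hM0.le)
  have hlogN0 : 0 ≤ Real.log N := Real.log_natCast_nonneg N
  set F : ℕ → ℝ := fun n ↦ (lam * ℓ - Real.log (M / n)) ^ q * S₁ M n * S₂ M n with hF
  have hgoal : |∑ c ∈ Icc 1 N, ∑ g ∈ Icc 1 (N / c), (μ g : ℝ) * c * Real.log g ^ t * (W (c * g) ^ 2 *
      ((lam * ℓ - Real.log (M / ((c * g : ℕ) : ℝ))) ^ q * S₁ M (c * g) * S₂ M (c * g)))| ≤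
      (K₁ * K₂ * (48 * A * 3) + 1) * ℓ ^ (t + q + r₁ + r₂) / ℓ ^ (s + 2) := by
    refine (abs_selbergCollapse_logPow_le ht N F).trans ?_
    have hterm : ∀ n ∈ Icc 1 N, |W n| * kappa n * |F n| ≤
        K₁ * K₂ * ℓ ^ (q + r₁ + r₂) / ℓ ^ (s + 2) * (kappa n * divWeight n ^ 2 / n) := by
      intro n hn
      have hn' := Finset.mem_Icc.1 hn
      have hn0 : n ≠ 0 := by omega
      have hnM : (n : ℝ) ≤ M := le_trans (by exact_mod_cast hn'.2) (Nat.floor_le hM0.le)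
      have hD := divWeight_nonneg n
      have hκ := kappa_nonneg₃ n
      have hW := abs_W_le n
      have hB : |(lam * ℓ - Real.log (M / n)) ^ q| ≤ ℓ ^ q := by
        rw [abs_pow]; exact pow_le_pow_left₀ (abs_nonneg _) (abs_lam_mul_log_sub_log_div_le hlam0 hlam1 hM hn0 hnM) q
      have hS := mul_le_mul (hb₁ M hM n hn0 hnM) (hb₂ M hM n hn0 hnM) (abs_nonneg _) (by positivity)
      have hF' : |F n| ≤ ℓ ^ q * (K₁ * divWeight n * ℓ ^ r₁ / ℓ ^ s * (K₂ * divWeight n * ℓ ^ r₂ / ℓ ^ 2)) := by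
        simp only [hF]
        rw [abs_mul, abs_mul, mul_assoc]
        exact mul_le_mul hB hS (by positivity) (by positivity)
      have hn0' : (0 : ℝ) < n := by exact_mod_cast Nat.pos_of_ne_zero hn0
      calc |W n| * kappa n * |F n|
          ≤ (n : ℝ)⁻¹ * kappa n * (ℓ ^ q * (K₁ * divWeight n * ℓ ^ r₁ / ℓ ^ s * (K₂ * divWeight n * ℓ ^ r₂ / ℓ ^ 2))) := by
            gcongr
        _ = K₁ * K₂ * ℓ ^ (q + r₁ + r₂) / ℓ ^ (s + 2) * (kappa n * divWeight n ^ 2 / n) := by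
            rw [pow_add, pow_add, pow_add]; field_simp
    have hsum : ∑ n ∈ Icc 1 N, |W n| * kappa n * |F n| ≤
        K₁ * K₂ * ℓ ^ (q + r₁ + r₂) / ℓ ^ (s + 2) * (48 * A * (3 * ℓ)) := by
      calc _ ≤ ∑ n ∈ Icc 1 N, K₁ * K₂ * ℓ ^ (q + r₁ + r₂) / ℓ ^ (s + 2) * (kappa n * divWeight n ^ 2 / n) :=
            Finset.sum_le_sum hterm
        _ = K₁ * K₂ * ℓ ^ (q + r₁ + r₂) / ℓ ^ (s + 2) * ∑ n ∈ Icc 1 N, kappa n * divWeight n ^ 2 / n := by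
            rw [Finset.mul_sum]
        _ ≤ K₁ * K₂ * ℓ ^ (q + r₁ + r₂) / ℓ ^ (s + 2) * (48 * A * (2 + Real.log N)) := by
            refine mul_le_mul_of_nonneg_left ?_ (by positivity)
            have := sum_kappa_divWeight_sq_div_le hN1
            rw [← hA] at this
            exact this
        _ ≤ K₁ * K₂ * ℓ ^ (q + r₁ + r₂) / ℓ ^ (s + 2) * (48 * A * (3 * ℓ)) := by gcongr; linarith
    have hpow : Real.log N ^ (t - 1) ≤ ℓ ^ (t - 1) := pow_le_pow_left₀ hlogN0 hlogN _
    have hsum0 : 0 ≤ ∑ n ∈ Icc 1 N, |W n| * kappa n * |F n| :=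
      Finset.sum_nonneg fun n _ ↦ by have := kappa_nonneg₃ n; positivity
    calc Real.log N ^ (t - 1) * ∑ n ∈ Icc 1 N, |W n| * kappa n * |F n|
        ≤ ℓ ^ (t - 1) * (K₁ * K₂ * ℓ ^ (q + r₁ + r₂) / ℓ ^ (s + 2) * (48 * A * (3 * ℓ))) :=
          mul_le_mul hpow hsum hsum0 (by positivity)
      _ = K₁ * K₂ * (48 * A * 3) * (ℓ ^ (t - 1) * ℓ * ℓ ^ (q + r₁ + r₂)) / ℓ ^ (s + 2) := by ring
      _ = K₁ * K₂ * (48 * A * 3) * ℓ ^ (t + q + r₁ + r₂) / ℓ ^ (s + 2) := by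
          rw [pow_sub_one_mul (by omega : t ≠ 0) ℓ, ← pow_add, show t + (q + r₁ + r₂) = t + q + r₁ + r₂ by ring]
      _ ≤ (K₁ * K₂ * (48 * A * 3) + 1) * ℓ ^ (t + q + r₁ + r₂) / ℓ ^ (s + 2) := by gcongr; linarith
  simpa only [hS₁, hS₂] using hgoal

end Summit.Parity.GeneralizedHardyLittlewood.Theorems.MomentsBeyondDiagonal.DiagKernel

end
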